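import Mathlib

/-!
# Entropic (Jeffreys–Bhattacharyya) bounds, finite form

Soloist report `solo-AtomisticToContinuum-informed`, `paper/sharpest.md` §4.8, step (1)–(2) of
Theorem D (see `SoloInformedPositiveDefiniteJastrow`): for probability vectors `η, p > 0`,
`BC(η,p) = ∑ √(ηᵢpᵢ) ≥ exp(-KL(η‖p)/2)` (weighted AM–GM), hence `BC² ≥ exp(-J/2)` with `J` the
Jeffreys divergence; the slice form with `p = g²/∑g²` in which the normalisation drops out of
the logarithm; and the finite Jensen inequality for `exp`. All folklore; recorded as tools.
-/

noncomputable section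

open Finset

namespace Summit.AtomisticToContinuum.BoseEinsteinCondensation.Theorems

section Entropic

variable {ι : Type*}

/-- **Gibbs–Jensen lower bound for the Bhattacharyya coefficient** (finite form): for a
probability vector `η` and a positive vector `p` on `s`,
`exp(½ ∑ ηᵢ log(pᵢ/ηᵢ)) ≤ ∑ √(ηᵢ pᵢ)`, i.e. `BC(η,p) ≥ e^{-KL(η‖p)/2}`
(weighted AM–GM). [folklore] -/
theorem SoloInformed.exp_half_sum_log_le_bhattacharyya (s : Finset ι) (η p : ι → ℝ)
    (hη : ∀ i ∈ s, 0 < η i) (hp : ∀ i ∈ s, 0 < p i) (hη1 : ∑ i ∈ s, η i = 1) :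
    Real.exp ((1 / 2) * ∑ i ∈ s, η i * Real.log (p i / η i)) ≤
      ∑ i ∈ s, Real.sqrt (η i * p i) := by
  have hz : ∀ i ∈ s, 0 ≤ Real.sqrt (p i / η i) := fun i _ => Real.sqrt_nonneg _
  have hgm := Real.geom_mean_le_arith_mean_weighted s η (fun i => Real.sqrt (p i / η i))
    (fun i hi => (hη i hi).le) hη1 hz
  have hL : ∏ i ∈ s, Real.sqrt (p i / η i) ^ η i =
      Real.exp ((1 / 2) * ∑ i ∈ s, η i * Real.log (p i / η i)) := by
    rw [Finset.mul_sum, Real.exp_sum]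
    refine Finset.prod_congr rfl fun i hi => ?_
    have hpos : 0 < p i / η i := div_pos (hp i hi) (hη i hi)
    rw [Real.rpow_def_of_pos (Real.sqrt_pos.2 hpos), Real.log_sqrt hpos.le]
    congr 1
    ring
  have hR : ∑ i ∈ s, η i * Real.sqrt (p i / η i) = ∑ i ∈ s, Real.sqrt (η i * p i) := by
    refine Finset.sum_congr rfl fun i hi => ?_
    have hne : η i ≠ 0 := (hη i hi).ne'
    have hmul : η i * p i = η i ^ 2 * (p i / η i) := by
      field_simp
    rw [hmul, Real.sqrt_mul (sq_nonneg _), Real.sqrt_sq (hη i hi).le]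
  rw [← hL, ← hR]
  exact hgm

/-- **Symmetrised (Jeffreys) entropic bound**: for probability vectors `η, p > 0` on `s`,
`exp(-½ J(η,p)) ≤ BC(η,p)²` with `J(η,p) = ∑ (ηᵢ - pᵢ)(log ηᵢ - log pᵢ)` the Jeffreys
divergence `KL(η‖p) + KL(p‖η)` and `BC = ∑ √(ηᵢ pᵢ)`. [folklore] -/
theorem SoloInformed.exp_neg_half_jeffreys_le_bhattacharyya_sq (s : Finset ι) (η p : ι → ℝ)
    (hη : ∀ i ∈ s, 0 < η i) (hp : ∀ i ∈ s, 0 < p i) (hη1 : ∑ i ∈ s, η i = 1)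
    (hp1 : ∑ i ∈ s, p i = 1) :
    Real.exp (-(1 / 2) * ∑ i ∈ s, (η i - p i) * (Real.log (η i) - Real.log (p i))) ≤
      (∑ i ∈ s, Real.sqrt (η i * p i)) ^ 2 := by
  have h1 := SoloInformed.exp_half_sum_log_le_bhattacharyya s η p hη hp hη1
  have h2 := SoloInformed.exp_half_sum_log_le_bhattacharyya s p η hp hη hp1
  have h2' : Real.exp ((1 / 2) * ∑ i ∈ s, p i * Real.log (η i / p i)) ≤
      ∑ i ∈ s, Real.sqrt (η i * p i) := by
    have hc : ∑ i ∈ s, Real.sqrt (p i * η i) = ∑ i ∈ s, Real.sqrt (η i * p i) :=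
      Finset.sum_congr rfl fun i _ => by rw [mul_comm]
    rw [← hc]
    exact h2
  have hsum : -(1 / 2) * ∑ i ∈ s, (η i - p i) * (Real.log (η i) - Real.log (p i)) =
      (1 / 2) * ∑ i ∈ s, η i * Real.log (p i / η i) +
        (1 / 2) * ∑ i ∈ s, p i * Real.log (η i / p i) := by
    rw [← mul_add, ← Finset.sum_add_distrib, neg_mul, ← mul_neg, ← Finset.sum_neg_distrib]
    congr 1
    refine Finset.sum_congr rfl fun i hi => ?_
    rw [Real.log_div (hp i hi).ne' (hη i hi).ne', Real.log_div (hη i hi).ne' (hp i hi).ne']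
    ring
  have hB0 : 0 ≤ ∑ i ∈ s, Real.sqrt (η i * p i) := Finset.sum_nonneg fun i _ => Real.sqrt_nonneg _
  rw [hsum, Real.exp_add, sq]
  exact mul_le_mul h1 h2' (Real.exp_pos _).le hB0

/-- **Slice inequality** (the occupation step): for a probability vector `η > 0` and a positive
vector `g` on `s`, with `S = ∑ gᵢ²` and `p = g²/S`,
`S · exp(-J(η,p)/2) ≤ (∑ √ηᵢ gᵢ)²`, written with the normalisation-free form
`S · J(η,p) = ∑ (ηᵢ S - gᵢ²)(log ηᵢ - log gᵢ²)` (the partition function `S` drops out of the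
logarithm because `∑ (ηᵢ - pᵢ) = 0`). [folklore] -/
theorem SoloInformed.sq_sum_sqrt_mul_ge_exp_jeffreys (s : Finset ι) (η g : ι → ℝ)
    (hη : ∀ i ∈ s, 0 < η i) (hg : ∀ i ∈ s, 0 < g i) (hη1 : ∑ i ∈ s, η i = 1) :
    (∑ i ∈ s, g i ^ 2) * Real.exp (-(1 / 2) * ((∑ i ∈ s, (η i * (∑ j ∈ s, g j ^ 2) - g i ^ 2) *
        (Real.log (η i) - Real.log (g i ^ 2))) / ∑ j ∈ s, g j ^ 2)) ≤
      (∑ i ∈ s, Real.sqrt (η i) * g i) ^ 2 := by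
  have hne : s.Nonempty := by
    by_contra h
    rw [Finset.not_nonempty_iff_eq_empty] at h
    rw [h, Finset.sum_empty] at hη1
    exact zero_ne_one hη1
  set S := ∑ j ∈ s, g j ^ 2 with hS
  have hSpos : 0 < S := Finset.sum_pos (fun i hi => pow_pos (hg i hi) 2) hne
  have hS0 : S ≠ 0 := hSpos.ne'
  have hppos : ∀ i ∈ s, 0 < g i ^ 2 / S := fun i hi => div_pos (pow_pos (hg i hi) 2) hSpos
  have hp1 : ∑ i ∈ s, g i ^ 2 / S = 1 := by rw [← Finset.sum_div, div_self hS0]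
  have hB := SoloInformed.exp_neg_half_jeffreys_le_bhattacharyya_sq s η (fun i => g i ^ 2 / S)
    hη hppos hη1 hp1
  have hexpo : -(1 / 2) * ((∑ i ∈ s, (η i * S - g i ^ 2) *
      (Real.log (η i) - Real.log (g i ^ 2))) / S) =
      -(1 / 2) * ∑ i ∈ s, (η i - g i ^ 2 / S) * (Real.log (η i) - Real.log (g i ^ 2 / S)) := by
    have hlog : ∀ i ∈ s, Real.log (g i ^ 2 / S) = Real.log (g i ^ 2) - Real.log S :=
      fun i hi => Real.log_div (pow_pos (hg i hi) 2).ne' hS0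
    have h0 : ∑ i ∈ s, (η i - g i ^ 2 / S) * Real.log S = 0 := by
      rw [← Finset.sum_mul, Finset.sum_sub_distrib, hη1, hp1, sub_self, zero_mul]
    congr 1
    rw [Finset.sum_div]
    calc ∑ i ∈ s, (η i * S - g i ^ 2) * (Real.log (η i) - Real.log (g i ^ 2)) / S
        = ∑ i ∈ s, ((η i - g i ^ 2 / S) * (Real.log (η i) - Real.log (g i ^ 2 / S)) -
            (η i - g i ^ 2 / S) * Real.log S) := by
          refine Finset.sum_congr rfl fun i hi => ?_
          rw [hlog i hi]
          field_simp
          ring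
      _ = _ := by rw [Finset.sum_sub_distrib, h0, sub_zero]
  have hsq : ∑ i ∈ s, Real.sqrt (η i) * g i =
      Real.sqrt S * ∑ i ∈ s, Real.sqrt (η i * (g i ^ 2 / S)) := by
    rw [Finset.mul_sum]
    refine Finset.sum_congr rfl fun i hi => ?_
    have hid : S * (η i * (g i ^ 2 / S)) = η i * g i ^ 2 := by
      field_simp
    rw [← Real.sqrt_mul hSpos.le, hid, Real.sqrt_mul (hη i hi).le, Real.sqrt_sq (hg i hi).le]
  rw [hexpo, hsq, mul_pow, Real.sq_sqrt hSpos.le]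
  exact mul_le_mul_of_nonneg_left hB hSpos.le

/-- **Finite Jensen inequality for `exp`**: `exp(∑ wᵢ Jᵢ) ≤ ∑ wᵢ exp(Jᵢ)` for weights `wᵢ ≥ 0`
summing to `1`. [folklore] -/
theorem SoloInformed.exp_sum_mul_le_sum_mul_exp (s : Finset ι) (w J : ι → ℝ)
    (hw : ∀ i ∈ s, 0 ≤ w i) (hw1 : ∑ i ∈ s, w i = 1) :
    Real.exp (∑ i ∈ s, w i * J i) ≤ ∑ i ∈ s, w i * Real.exp (J i) := by
  have h := (convexOn_exp).map_sum_le hw hw1 (fun i _ => Set.mem_univ (J i))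
  simpa only [smul_eq_mul] using h

end Entropic

end Summit.AtomisticToContinuum.BoseEinsteinCondensation.Theorems

end
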